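import Literature.MathematicalPhysics.QuantumLattice.FermionProductStateEntropy
import HarnessLib

/-!
# Entropy of a product of even box states stacked along the lexicographic order: `S(∏ Γσ_i) = Σ S(σ_i)`

Topic `MathematicalPhysics/QuantumLattice`; the iterated form of `FermionProductStateEntropy.lean`
(`vonNeumannEntropy_fermionProduct_of_cut`). Regions `B 0, B 1, …` of `ℤ^d` are STACKED: every site of `B i` is
lexicographically below every site of `B j` for `i < j` (e.g. boxes `[ia, (i+1)a) × [0, w)` along the slow
coordinate). The accumulated regions `U n = B 0 ∪ ⋯ ∪ B n` and the accumulated product states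
`ρ n = Γ(ρ (n−1)) · Γ(σ n) ∈ 𝔄_{U n}` of even density matrices `σ i ∈ 𝔄_{B i}` are defined by recursion
(`stackRegion`, `stackState`), and

* `posSemidef_stackState`, `trace_stackState`, `parityAut_stackState` — `ρ n` is an even density matrix;
* `vonNeumannEntropy_stackState` — **`S(ρ n) = Σ_{i ≤ n} S(σ i)`**.

With `vonNeumannEntropy_unitary_conj` this is the entropy of a DRESSED stacked trial state `W (∏ Γσ_i) W⋆`
(the Gibbs-variational free-energy certificates of the thermal «f⁺ lever»: `S = Σ_i S(σ_i) ≥ Σ_i −log tr σ_i²`).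
Everything is PROVED; the two definitions are the recursion (bookkeeping).

References: Araki–Moriya 2003 §4.3 (product states of even states) [ArakiMoriya2003]; Nielsen–Chuang 2010
§11.3.4 eq. (11.58) (additivity) [NielsenChuang2010].
-/

noncomputable section

namespace Literature.MathematicalPhysics.QuantumLattice

open Matrix Finset HubbardWave0 Literature.Probability.LatticeModels
open scoped ComplexOrder
open Literature.InformationTheory.Entropy (vonNeumannEntropy)

variable {d : ℕ}

/-- The accumulated region `U n = B 0 ∪ B 1 ∪ ⋯ ∪ B n` (recursively `U (n+1) = U n ∪ B (n+1)`).
[cite: ArakiMoriya2003, §4.3] -/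
def stackRegion (B : ℕ → Finset (Site d)) : ℕ → Finset (Site d)
  | 0 => B 0
  | n + 1 => stackRegion B n ∪ B (n + 1)

/-- The accumulated product state `ρ n ∈ 𝔄_{U n}`: `ρ 0 = σ 0`, `ρ (n+1) = Γ_{U n ⊆ U (n+1)}(ρ n) · Γ_{B (n+1) ⊆ U (n+1)}(σ (n+1))`.
[cite: ArakiMoriya2003, §4.3] -/
def stackState (B : ℕ → Finset (Site d)) (σ : ∀ i, FermionOp (B i)) : ∀ n, FermionOp (stackRegion B n)
  | 0 => σ 0
  | n + 1 =>
      fermionEmbed (PolySite.incl (Finset.subset_union_left : stackRegion B n ⊆ stackRegion B n ∪ B (n + 1)))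
          (stackState B σ n) *
        fermionEmbed (PolySite.incl (Finset.subset_union_right : B (n + 1) ⊆ stackRegion B n ∪ B (n + 1)))
          (σ (n + 1))

/-- Sites of `U n` lie in some `B i`, `i ≤ n`. [folklore] -/
private theorem mem_stackRegion_iff (B : ℕ → Finset (Site d)) (n : ℕ) (x : Site d) :
    x ∈ stackRegion B n ↔ ∃ i ≤ n, x ∈ B i := by
  induction n with
  | zero =>
      simp only [stackRegion, Nat.le_zero]
      exact ⟨fun h => ⟨0, rfl, h⟩, fun ⟨i, hi, h⟩ => by subst hi; exact h⟩
  | succ n ih =>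
      simp only [stackRegion, Finset.mem_union, ih]
      constructor
      · rintro (⟨i, hi, h⟩ | h)
        · exact ⟨i, Nat.le_succ_of_le hi, h⟩
        · exact ⟨n + 1, le_rfl, h⟩
      · rintro ⟨i, hi, h⟩
        rcases Nat.lt_succ_iff_lt_or_eq.1 (Nat.lt_succ_of_le hi) with hlt | heq
        · exact Or.inl ⟨i, Nat.lt_succ_iff.1 hlt, h⟩
        · subst heq; exact Or.inr h

/-- Stacking hypothesis ⇒ the cut hypothesis of `vonNeumannEntropy_fermionProduct_of_cut` at step `n+1`. [folklore] -/
private theorem stack_cut {B : ℕ → Finset (Site d)} (hstack : ∀ i j, i < j → ∀ x ∈ B i, ∀ y ∈ B j, toLex x < toLex y)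
    (n : ℕ) : ∀ x ∈ stackRegion B n, ∀ y ∈ B (n + 1), toLex x < toLex y := by
  intro x hx y hy
  obtain ⟨i, hi, hxi⟩ := (mem_stackRegion_iff B n x).1 hx
  exact hstack i (n + 1) (Nat.lt_succ_of_le hi) x hxi y hy

/-- **The stacked product state is an even density matrix** (`PosSemidef`, trace `1`, `Θ ρ = ρ`), for even density
matrices `σ i`. [cite: ArakiMoriya2003, §4.3] -/
theorem posSemidef_trace_parityAut_stackState {B : ℕ → Finset (Site d)}
    (hstack : ∀ i j, i < j → ∀ x ∈ B i, ∀ y ∈ B j, toLex x < toLex y)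
    {σ : ∀ i, FermionOp (B i)} (hσ : ∀ i, (σ i).PosSemidef) (htr : ∀ i, (σ i).trace = 1)
    (hev : ∀ i, parityAut (σ i) = σ i) (n : ℕ) :
    (stackState B σ n).PosSemidef ∧ (stackState B σ n).trace = 1 ∧ parityAut (stackState B σ n) = stackState B σ n := by
  induction n with
  | zero => exact ⟨hσ 0, htr 0, hev 0⟩
  | succ n ih =>
      obtain ⟨hpsd, htr', hev'⟩ := ih
      have h := posSemidef_fermionProduct_of_cut (stack_cut hstack n) hpsd (hσ (n + 1)) (hev (n + 1))
      have htr1 : (fermionEmbed (PolySite.incl (Finset.subset_union_left :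
            stackRegion B n ⊆ stackRegion B n ∪ B (n + 1))) (stackState B σ n) *
          fermionEmbed (PolySite.incl (Finset.subset_union_right :
            B (n + 1) ⊆ stackRegion B n ∪ B (n + 1))) (σ (n + 1))).trace = 1 := by
        rw [h.2, htr (n + 1), htr', mul_one]
      have hev1 : parityAut (fermionEmbed (PolySite.incl (Finset.subset_union_left :
            stackRegion B n ⊆ stackRegion B n ∪ B (n + 1))) (stackState B σ n) *
          fermionEmbed (PolySite.incl (Finset.subset_union_right :
            B (n + 1) ⊆ stackRegion B n ∪ B (n + 1))) (σ (n + 1))) =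
          fermionEmbed (PolySite.incl (Finset.subset_union_left :
            stackRegion B n ⊆ stackRegion B n ∪ B (n + 1))) (stackState B σ n) *
          fermionEmbed (PolySite.incl (Finset.subset_union_right :
            B (n + 1) ⊆ stackRegion B n ∪ B (n + 1))) (σ (n + 1)) := by
        rw [map_mul, ← fermionEmbed_parityAut, ← fermionEmbed_parityAut, hev', hev (n + 1)]
      exact ⟨h.1, htr1, hev1⟩

/-- **Additivity of entropy along a lexicographic stack**: for regions `B i` stacked along the lexicographic order
and even density matrices `σ i ∈ 𝔄_{B i}`, the accumulated product state satisfies `S(ρ n) = Σ_{i ≤ n} S(σ i)`.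
[cite: NielsenChuang2010, §11.3.4 eq. (11.58)] [cite: ArakiMoriya2003, §4.3] -/
theorem vonNeumannEntropy_stackState {B : ℕ → Finset (Site d)}
    (hstack : ∀ i j, i < j → ∀ x ∈ B i, ∀ y ∈ B j, toLex x < toLex y)
    {σ : ∀ i, FermionOp (B i)} (hσ : ∀ i, (σ i).PosSemidef) (htr : ∀ i, (σ i).trace = 1)
    (hev : ∀ i, parityAut (σ i) = σ i) (n : ℕ) :
    vonNeumannEntropy (stackState B σ n) = ∑ i ∈ Finset.range (n + 1), vonNeumannEntropy (σ i) := by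
  induction n with
  | zero => rw [Finset.sum_range_one]; rfl
  | succ n ih =>
      obtain ⟨hpsd, htr', -⟩ := posSemidef_trace_parityAut_stackState hstack hσ htr hev n
      have h := vonNeumannEntropy_fermionProduct_of_cut (stack_cut hstack n) hpsd.1 htr' (hσ (n + 1)).1
        (htr (n + 1)) (hev (n + 1))
      rw [ih, ← Finset.sum_range_succ] at h
      exact h

end Literature.MathematicalPhysics.QuantumLattice

end
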